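import Summits.QuantumAdvantage.AdviceFreeQNC0.AffBells26CubeIdentityGen
import Mathlib.Algebra.BigOperators.Group.Finset.Powerset
import HarnessLib

/-!
# `AffBells26.CubeTargetGen` PROVED — the target parity along a general move cube (planner qn-p1 g26, ROUND-25 §5.2; P-26b addendum 2)

Prover seat qn-prover-3 g14.  **`cubeTargetGen : CubeTargetGen`**: for a move system `(x, F, O)` with `m ≥ 2` moves whose owned sets do not
interact at cyclic distance `1` or `2`, the targets `N + Z(x_S) + p(x_S)` of the `2^m` cube points sum to `0 (mod 2)`.

Proof.  Along the cube the kernel line is `J ⊕ 1_{⋃_{j∈S} O j}` (move-system axiom), so adding one move `j₀` flips it exactly on `O j₀`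
(`kline_xF_insert`).  Hence `Z(x_{S+j₀}) + Z(x_S) ≡ |O j₀|` (`Fib19.zeros_flipAt_add_mod_two`), and `p(x_{S+j₀}) + p(x_S) ≡ K₁ + K₂` with
constants `K₁, K₂`: the distance-two pair indicators change only at the positions `i` with `i` or `i+2` in `O j₀`, and there — by the
non-interaction hypothesis — the line of `x_S` coincides with the base line `J` (`pairs2_step`).  So `T(S+j₀) + T(S)` has a parity
independent of `S`, and splitting the cube along `j₀` (`Finset.sum_powerset_insert`) gives `2^{m−1}·κ ≡ 0`.

With `targetFormula`, `cubeIdentityGen` and this file, the planner's packaging `noPerfectAffineBells3_of_S26gen` makes (NP₀) follow from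
THEOREM S26-gen alone: `noPerfectAffineBells3_of_S26gen' : CubeRefutableGenAll → NoPerfectAffineBells3`.
WHAT THIS IS NOT: `CreationsMoveSystem` and the density block are NOT proved here; instrument for crux stmt-QuantumAdvantage-22907
(route DWalkThree); separation NOT moved.
-/

namespace Summit.QuantumAdvantage.AdviceFreeQNC0

namespace AffBells26

open Finset Literature.Computability.QuantumComplexity Literature.Computability.QuantumComplexity.RingHLF
open AffBells23 AffBells24 Fib19

variable {N m : ℕ}

/-! ### The kernel line along a move cube -/

/-- Adding one move flips the kernel line exactly on its owned set. -/
theorem kline_xF_insert {x : Fin N → Bool} {F O : Fin m → Finset (Fin N)} (hMS : MoveSystem x F O) {j₀ : Fin m}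
    {S : Finset (Fin m)} (hj : j₀ ∉ S) : kline (xF x F (insert j₀ S)) = flipAt (kline (xF x F S)) (O j₀) := by
  funext i
  rw [(hMS.2.1 _).2 i]
  unfold flipAt
  rw [(hMS.2.1 S).2 i]
  by_cases h0 : i ∈ O j₀
  · have hnot : ¬ ∃ j ∈ S, i ∈ O j := by
      rintro ⟨j, hjS, hij⟩
      have hne : j ≠ j₀ := fun e => hj (e ▸ hjS)
      exact disjoint_left.1 (hMS.2.2.1 j j₀ hne).2 hij h0
    rw [decide_eq_true ⟨j₀, mem_insert_self _ _, h0⟩, decide_eq_false hnot, decide_eq_true h0]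
    cases kline x i <;> rfl
  · have hiff : (∃ j ∈ insert j₀ S, i ∈ O j) ↔ ∃ j ∈ S, i ∈ O j := by
      constructor
      · rintro ⟨j, hj', hij⟩
        rw [mem_insert] at hj'
        rcases hj' with rfl | hjS
        · exact absurd hij h0
        · exact ⟨j, hjS, hij⟩
      · rintro ⟨j, hjS, hij⟩
        exact ⟨j, mem_insert_of_mem hjS, hij⟩
    rw [decide_eq_false h0, Bool.xor_false]
    by_cases h1 : ∃ j ∈ S, i ∈ O j
    · rw [decide_eq_true h1, decide_eq_true (hiff.2 h1)]
    · rw [decide_eq_false h1, decide_eq_false (fun h => h1 (hiff.1 h))]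

/-- Near the owned set of `j₀` (positions `i` with `i` or `i+2` in `O j₀`) the line of `x_S` (`j₀ ∉ S`) is the base line `J`, when the owned
sets of different moves are never at distance `1` or `2`. -/
theorem kline_xF_eq_near {x : Fin N → Bool} {F O : Fin m → Finset (Fin N)} (hMS : MoveSystem x F O)
    (hO : ∀ j j' : Fin m, j ≠ j' → ∀ u ∈ O j, ∀ v ∈ O j', v ≠ nxt (nxt u) ∧ v ≠ nxt u) {j₀ : Fin m} {S : Finset (Fin m)}
    (hj : j₀ ∉ S) {i : Fin N} (hi : i ∈ O j₀ ∨ nxt (nxt i) ∈ O j₀) :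
    kline (xF x F S) i = kline x i ∧ kline (xF x F S) (nxt (nxt i)) = kline x (nxt (nxt i)) := by
  have key : ∀ k : Fin N, (¬ ∃ j ∈ S, k ∈ O j) → kline (xF x F S) k = kline x k := by
    intro k hk
    rw [(hMS.2.1 S).2 k, decide_eq_false hk, Bool.xor_false]
  constructor
  · apply key
    rintro ⟨j, hjS, hij⟩
    have hne : j ≠ j₀ := fun e => hj (e ▸ hjS)
    rcases hi with h0 | h2
    · exact disjoint_left.1 (hMS.2.2.1 j j₀ hne).2 hij h0
    · exact (hO j j₀ hne i hij (nxt (nxt i)) h2).1 rfl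
  · apply key
    rintro ⟨j, hjS, hij⟩
    have hne : j ≠ j₀ := fun e => hj (e ▸ hjS)
    rcases hi with h0 | h2
    · exact (hO j₀ j (Ne.symm hne) i h0 (nxt (nxt i)) hij).1 rfl
    · exact disjoint_left.1 (hMS.2.2.1 j j₀ hne).2 hij h2

/-! ### Distance-two pairs: the step along one move has constant parity -/

/-- Splitting a count along a predicate. -/
theorem card_filter_split {α : Type*} (s : Finset α) (P Q : α → Prop) [DecidablePred P] [DecidablePred Q] :
    (s.filter P).card = (s.filter fun a => P a ∧ ¬ Q a).card + (s.filter fun a => P a ∧ Q a).card := by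
  rw [← card_filter_add_card_filter_not (s := s.filter P) (fun a => ¬ Q a), filter_filter, filter_filter]
  congr 2
  ext a
  simp only [mem_filter, not_not]

/-- **The pairs step**: `p(flipAt K (O j₀)) + p(K) ≡ K₁ + K₂ (mod 2)` with constants read off the base line `J`, whenever `K` agrees with
`J` near `O j₀`. -/
theorem pairs2_step (J K : Fin N → Bool) (W : Finset (Fin N))
    (hagree : ∀ i, (i ∈ W ∨ nxt (nxt i) ∈ W) → K i = J i ∧ K (nxt (nxt i)) = J (nxt (nxt i))) :
    (pairs2 (flipAt K W) + pairs2 K) % 2 =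
      ((univ.filter fun i : Fin N => (i ∈ W ∨ nxt (nxt i) ∈ W) ∧ flipAt J W i = false ∧ flipAt J W (nxt (nxt i)) = false).card +
        (univ.filter fun i : Fin N => (i ∈ W ∨ nxt (nxt i) ∈ W) ∧ J i = false ∧ J (nxt (nxt i)) = false).card) % 2 := by
  classical
  -- split both counts along `near W`
  have hfar : ∀ i, ¬ (i ∈ W ∨ nxt (nxt i) ∈ W) → (flipAt K W i = K i ∧ flipAt K W (nxt (nxt i)) = K (nxt (nxt i))) := by
    intro i hi
    push Not at hi
    exact ⟨flipAt_apply_of_not_mem hi.1, flipAt_apply_of_not_mem hi.2⟩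
  unfold pairs2
  rw [card_filter_split univ (fun i => flipAt K W i = false ∧ flipAt K W (nxt (nxt i)) = false)
      (fun i => i ∈ W ∨ nxt (nxt i) ∈ W),
    card_filter_split univ (fun i => K i = false ∧ K (nxt (nxt i)) = false) (fun i => i ∈ W ∨ nxt (nxt i) ∈ W)]
  -- far parts agree
  have e1 : (univ.filter fun i : Fin N => (flipAt K W i = false ∧ flipAt K W (nxt (nxt i)) = false) ∧
        ¬ (i ∈ W ∨ nxt (nxt i) ∈ W)) =
      univ.filter fun i : Fin N => (K i = false ∧ K (nxt (nxt i)) = false) ∧ ¬ (i ∈ W ∨ nxt (nxt i) ∈ W) := by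
    refine filter_congr fun i _ => ?_
    constructor
    · rintro ⟨h, hn⟩; rw [(hfar i hn).1, (hfar i hn).2] at h; exact ⟨h, hn⟩
    · rintro ⟨h, hn⟩; rw [← (hfar i hn).1, ← (hfar i hn).2] at h; exact ⟨h, hn⟩
  -- near parts are the constants
  have e2 : (univ.filter fun i : Fin N => (flipAt K W i = false ∧ flipAt K W (nxt (nxt i)) = false) ∧
        (i ∈ W ∨ nxt (nxt i) ∈ W)) =
      univ.filter fun i : Fin N => (i ∈ W ∨ nxt (nxt i) ∈ W) ∧ flipAt J W i = false ∧ flipAt J W (nxt (nxt i)) = false := by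
    refine filter_congr fun i _ => ?_
    constructor
    · rintro ⟨h, hn⟩
      obtain ⟨a1, a2⟩ := hagree i hn
      refine ⟨hn, ?_, ?_⟩
      · have := h.1; unfold flipAt at this ⊢; rw [a1] at this; exact this
      · have := h.2; unfold flipAt at this ⊢; rw [a2] at this; exact this
    · rintro ⟨hn, h1, h2⟩
      obtain ⟨a1, a2⟩ := hagree i hn
      refine ⟨⟨?_, ?_⟩, hn⟩
      · unfold flipAt at h1 ⊢; rw [a1]; exact h1
      · unfold flipAt at h2 ⊢; rw [a2]; exact h2
  have e3 : (univ.filter fun i : Fin N => (K i = false ∧ K (nxt (nxt i)) = false) ∧ (i ∈ W ∨ nxt (nxt i) ∈ W)) =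
      univ.filter fun i : Fin N => (i ∈ W ∨ nxt (nxt i) ∈ W) ∧ J i = false ∧ J (nxt (nxt i)) = false := by
    refine filter_congr fun i _ => ?_
    constructor
    · rintro ⟨h, hn⟩
      obtain ⟨a1, a2⟩ := hagree i hn
      exact ⟨hn, by rw [← a1]; exact h.1, by rw [← a2]; exact h.2⟩
    · rintro ⟨hn, h1, h2⟩
      obtain ⟨a1, a2⟩ := hagree i hn
      exact ⟨⟨by rw [a1]; exact h1, by rw [a2]; exact h2⟩, hn⟩
  rw [e1, e2, e3]
  omega

/-! ### Q1'-gen -/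

/-- **`CubeTargetGen`**: along a move cube with non-interacting owned sets and `m ≥ 2` moves, the targets sum to `0 (mod 2)`. -/
theorem cubeTargetGen : CubeTargetGen := by
  classical
  intro N m hN hm x F O hMS hO
  -- one move j₀ and the rest E
  have hm0 : 0 < m := by omega
  set j₀ : Fin m := ⟨0, hm0⟩ with hj₀
  set E := (univ : Finset (Fin m)).erase j₀ with hE
  -- the constant parity of T(S) + T(S + j₀)
  set J := kline x with hJ
  set K₁ := (univ.filter fun i : Fin N => (i ∈ O j₀ ∨ nxt (nxt i) ∈ O j₀) ∧
    flipAt J (O j₀) i = false ∧ flipAt J (O j₀) (nxt (nxt i)) = false).card with hK₁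
  set K₂ := (univ.filter fun i : Fin N => (i ∈ O j₀ ∨ nxt (nxt i) ∈ O j₀) ∧ J i = false ∧ J (nxt (nxt i)) = false).card
    with hK₂
  have hstep : ∀ S ∈ E.powerset,
      ((N + zeros (kline (xF x F S)) + pairs2 (kline (xF x F S))) +
        (N + zeros (kline (xF x F (insert j₀ S))) + pairs2 (kline (xF x F (insert j₀ S))))) % 2 =
        ((O j₀).card + (K₁ + K₂)) % 2 := by
    intro S hS
    rw [mem_powerset, hE, subset_erase] at hS
    have hj : j₀ ∉ S := hS.2
    have hk := kline_xF_insert hMS hj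
    have hz := zeros_flipAt_add_mod_two (kline (xF x F S)) (O j₀)
    have hp := pairs2_step J (kline (xF x F S)) (O j₀) (fun i hi => kline_xF_eq_near hMS hO hj hi)
    rw [← hk] at hz hp
    rw [← hK₁, ← hK₂] at hp
    omega
  -- split the cube along j₀
  have huniv : (univ : Finset (Finset (Fin m))) = (insert j₀ E).powerset := by
    rw [hE, insert_erase (mem_univ _), powerset_univ]
  have hj₀E : j₀ ∉ E := by rw [hE]; exact notMem_erase _ _
  rw [huniv, sum_powerset_insert hj₀E, ← sum_add_distrib, Finset.sum_nat_mod, sum_congr rfl hstep, sum_const,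
    card_powerset, smul_eq_mul]
  have hEcard : 1 ≤ E.card := by
    rw [hE, card_erase_of_mem (mem_univ _), card_univ, Fintype.card_fin]; omega
  obtain ⟨k, hk⟩ : ∃ k, E.card = k + 1 := ⟨E.card - 1, by omega⟩
  rw [hk, pow_succ', mul_assoc]
  exact Nat.mul_mod_right 2 _

/-- **(NP₀) from S26-gen alone** (the planner's packaging with Q0, Q1-gen, Q1'-gen discharged). -/
theorem noPerfectAffineBells3_of_S26gen' (hS : CubeRefutableGenAll) : NoPerfectAffineBells3 :=
  noPerfectAffineBells3_of_S26gen targetFormula cubeIdentityGen cubeTargetGen hS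

end AffBells26

end Summit.QuantumAdvantage.AdviceFreeQNC0
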